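import Summits.BirchSwinnertonDyer.BirchSwinnertonDyer.Theorems.PrintX11aUpperNonSurjThreeSharpDescent
import Summits.BirchSwinnertonDyer.BirchSwinnertonDyer.Theorems.PrintX11aUpperNonSurjThreeConjADoor
import Summits.BirchSwinnertonDyer.BirchSwinnertonDyer.Theorems.PrintX11aUpperNonSurjThreeSharpLayerDescent
import Summits.BirchSwinnertonDyer.BirchSwinnertonDyer.Theorems.PrintX11aUpperNonSurjThreeSharpLocalNoTorsion
import HarnessLib

/-!
# Route `PrintX11a`, child crux U3 = `PrintX11a.UpperNonSurjThree` (item stmt-BirchSwinnertonDyer-20613),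
# line «finemu3», stub `FineMu.stub_conjA_three` — route-posited DEFINITIONS of the ♯-road: the level-0
# certificate predicate «`R♯(E,p) = 0`» (`SharpResidualTrivialAt`) and its by-name doors to (A), to
# `Typed.MissingUpperBoundAt` and to `BSDp` on the U3/U5 domain (cell `bsd-print-x11a`, width seat `bsd-line-x11a-p1-w2`,
# LEAD brief 2026-08-28T05:17:56Z «SharpDefs»; `--supports` 20613; closes nothing)

HONEST FRAMING.  BSD is not proved by any of this; nothing is asserted about any curve; the crux and its stubs
`stub_conjA_three` / `stub_conjA_hardThree` (statement (A) CLASS-WIDE on U3, an instance of Iwasawa's `μ`-conjecture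
for the non-abelian fields `ℚ(E[3])`) stay OPEN.  ONE definition (a PREDICATE on pairs with a body, no axiom, no
`@[conjecture]`, nothing asserted) + proved doors; every theorem on the BSD side is CONDITIONAL on the displayed
printed facts of the transfer (Stein–Wuthrich 6.1, GZK, modularity, Kato 12.4 / §17.13 inputs, Greenberg 1.5,
Wuthrich Cor. 18, Greenberg–Stevens), exactly as x11a-p2's per-pair (A)-door `ClassX11a.missingUpperBoundAt_of_conjAAt`.

WHY A DEFINITION AND NOT AN OBLIGATION NODE.  The LEAD's brief asked for «@[conjecture] obligation node + certificate
predicate + sorry-free per-pair door».  The siblings `…SharpNakayama` (p607083) and `…SharpDescent` (p608099) PROVE the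
critic's ♯0 criterion outright on the small-image locus (`E[p]` irreducible, `ρ̄_{E,p}` not onto):
«every `y ∈ H¹(ℚ, E[p])` restricting into `Sel₀(ℚ_∞, E[p^∞])` is `0`» ⟹ `Sel₀(ℚ_∞, E[p^∞]) = 0` ⟹ (A).  So NO node is
needed: the only typed object left is the NAME of the certificate, `SharpResidualTrivialAt W p` («`R♯(E,p) = 0`»,
§1), so that per-pair records display ONE hypothesis and apply ONE door.

THE CERTIFICATE (§1).  `R♯(E,p)` is the subgroup of the level-0 group `H¹(ℚ, E[p])` (`discreteH1 Γ_ℚ E[p]`, continuous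
cochains) of the classes `y` whose restriction to `Gal(ℚ̄/ℚ_∞) = ker κ`, pushed to `E[p^∞]`-coefficients
(`torsionToPrimaryH1Sub ∘ ResKernel.resSubgroup`), lies in the fine Selmer group `Sel₀(ℚ_∞, E[p^∞])`
(`fineSelmerInfty κ`: locally trivial at every place of `ℚ_∞`).  On the small-image locus `res` and `E[p] ↪ E[p^∞]`
are injective on `H¹` (`E(ℚ_∞)[p] = 0`, `…SharpDescent` §1–§2), so `R♯(E,p) ≅ Sel₀(ℚ_∞, E[p^∞])[p]^Γ = Sel₀♯(ℚ_∞)^Γ`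
— the critic's `R♯(E,p)` (Lines/finemu3.md (P2)), whose local description is: `y` unramified outside
`S = {p, ∞, bad}` with `loc_v y ∈ B_v := ker(H¹(ℚ_v, E[p]) → H¹(ℚ_{∞,w}, E[p^∞]))` for `v ∈ S` («A_w» pulled back
to level 0).  That LOCAL FORMULA — a finite computation in the class field theory of `L = ℚ(E[p])` with explicit
conditions at the primes of `L` over `S` — is what a kit engine evaluates; it is the recorder's / REF's audit object
and is deliberately NOT restated in the kernel (no local vocabulary is asserted equal to it here).
`SharpResidualTrivialAt W p` is the ♯0 («strong») certificate: by the theorem it forces `Sel₀(ℚ_∞, E[p^∞]) = 0`, so it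
can hold only at pairs with `X₀(E/ℚ_∞) = 0`; the first-layer variant ♯δ (`dim Sel₀♯_1 ≤ p − 1`) is NOT typed here.

Contents: §1 the predicate + `Iff.rfl` unfolding; §2 doors on the small-image locus (`.fineSelmerTrivialAt`,
`.conjAAt`, `.fineMuZeroAt`); §3 doors on `ClassX11a ∧ ¬Surj`: (A), `Typed.MissingUpperBoundAt` (∘ x11a-p2's
p607408), `BSDp` at a unit `#Ш_an`; §4 the class forms feeding the registered stubs `stub_conjA_three` /
`stub_conjA_hardThree` of Lines/finemu3.lean r1 VERBATIM from «`R♯ = 0` on the (hard) U3 domain».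

References: [CoatesSujatha2005] §3 statement (A); [GreenbergLNM1716] §1 p. 60, §3 Lemmas 3.1–3.2;
[DeoRaySujatha2023] §3 (c1)–(c3), Thm. 3.9 (the layer-0 road this generalises: no (c3));
[Kato2004Asterisque] §17.13; [Miller2011LMS] Def. 1.1; line card Lines/finemu3.md (P2); LEAD STATUS 05:17:56Z / 05:40:45Z.
-/

set_option linter.dupNamespace false
set_option autoImplicit false

noncomputable section

open scoped Classical

open WeierstrassCurve Field
  Literature.NumberTheory.EllipticCurves
  Literature.NumberTheory.EllipticCurves.ModularForms
  Literature.NumberTheory.EllipticCurves.Kato2004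
  Literature.NumberTheory.EllipticCurves.Rank1Residual
  Literature.NumberTheory.EllipticCurves.Rank1Residual.Typed
  Literature.NumberTheory.EllipticCurves.Wuthrich2014
  Literature.NumberTheory.EllipticCurves.SteinWuthrich2013
  Literature.NumberTheory.EllipticCurves.Greenberg1999
  Literature.NumberTheory.GaloisRepresentations
  Summit.BirchSwinnertonDyer.BirchSwinnertonDyer.Theorems.UpperNonSurjThreeSharp

namespace Summit.BirchSwinnertonDyer.Rank1Residual

/-! ### §1 The ♯0 certificate «`R♯(E,p) = 0`» as a predicate on pairs -/

/-- **`SharpResidualTrivialAt W p` — «`R♯(E,p) = 0`», the ♯0 certificate of line «finemu3» at the pair `(E, p)`**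
(a PREDICATE on pairs; nothing is asserted about any pair): for every cyclotomic `ℤ_p`-extension datum `κ` of `ℚ`,
every level-0 class `y ∈ H¹(ℚ, E[p])` (`discreteH1 Γ_ℚ E[p]`) whose restriction to `Gal(ℚ̄/ℚ_∞) = ker κ`, pushed
to `E[p^∞]`-coefficients, lies in the fine Selmer group `Sel₀(ℚ_∞, E[p^∞])` is ZERO — i.e. the residual group
`R♯(E,p) = {y ∈ H¹(ℚ, E[p]) : res_{ℚ_∞} y ∈ ι⁻¹ Sel₀(ℚ_∞, E[p^∞])}` vanishes.  Finite and decided per pair by a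
class-field-theoretic computation on `ℚ(E[p])` (unramified outside `S`, local conditions `B_v` at `v ∈ S`; line card
(P2)); on the small-image locus it EQUALS «`Sel₀(ℚ_∞, E[p^∞])[p]^Γ = 0`» and implies statement (A)
(`SharpResidualTrivialAt.conjAAt`, PROVED).
[cite: DeoRaySujatha2023, §3 and Thm. 3.9 (the layer-0 class-group criterion it generalises by dropping (c3))]
[cite: GreenbergLNM1716, §3 Lemmas 3.1–3.2 (Kummer lift and descent along `ℚ_∞/ℚ`)] -/
def SharpResidualTrivialAt (W : WeierstrassCurve ℚ) [W.IsElliptic] (p : ℕ) [Fact p.Prime] : Prop :=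
  ∀ κ : ZpExtension ℚ p, κ.IsCyclotomic →
    ∀ y : discreteH1 (absoluteGaloisGroup ℚ) (geomTorsion W (p : ℤ)),
      W.torsionToPrimaryH1Sub p κ.kerSubgroup
          (ResKernel.resSubgroup κ.kerSubgroup (geomTorsion W (p : ℤ)) y) ∈ W.fineSelmerInfty κ →
        y = 0

variable {W : WeierstrassCurve ℚ} [W.IsElliptic] {p : ℕ} [Fact p.Prime]

/-- Unfolding `SharpResidualTrivialAt` (`Iff.rfl`). [cite: DeoRaySujatha2023, §3] -/
theorem sharpResidualTrivialAt_iff :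
    SharpResidualTrivialAt W p ↔
      ∀ κ : ZpExtension ℚ p, κ.IsCyclotomic →
        ∀ y : discreteH1 (absoluteGaloisGroup ℚ) (geomTorsion W (p : ℤ)),
          W.torsionToPrimaryH1Sub p κ.kerSubgroup
              (ResKernel.resSubgroup κ.kerSubgroup (geomTorsion W (p : ℤ)) y) ∈ W.fineSelmerInfty κ →
            y = 0 :=
  Iff.rfl

/-! ### §2 Doors on the small-image locus (`E[p]` irreducible, `ρ̄_{E,p}` not onto) — PROVED, no named fact -/

/-- **`R♯(E,p) = 0 ⟹ Sel₀(ℚ_∞, E[p^∞]) = 0`** (`Rank1Residual.FineSelmerTrivialAt`) on the small-image locus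
(`…SharpDescent`, by name). [cite: GreenbergLNM1716, §3 Lemmas 3.1–3.2 and §1 p. 60] -/
theorem SharpResidualTrivialAt.fineSelmerTrivialAt (h : SharpResidualTrivialAt W p)
    (hirr : W.HasIrreducibleModPGaloisRep p) (hns : ¬ W.HasSurjectiveModNGaloisRep p) :
    FineSelmerTrivialAt W p :=
  fineSelmerTrivialAt_of_irr_of_not_surj_of_sharpResidual_eq_zero W p hirr hns h

/-- **`R♯(E,p) = 0 ⟹` statement (A) at the pair** (`Rank1Residual.ConjAAt W p`) on the small-image locus
(`…SharpDescent`, by name).  (A) is asserted for no curve: the certificate is the hypothesis.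
[cite: CoatesSujatha2005, §3 statement (A)] [cite: DeoRaySujatha2023, Thm. 3.9] -/
theorem SharpResidualTrivialAt.conjAAt (h : SharpResidualTrivialAt W p)
    (hirr : W.HasIrreducibleModPGaloisRep p) (hns : ¬ W.HasSurjectiveModNGaloisRep p) : ConjAAt W p :=
  conjAAt_of_irr_of_not_surj_of_sharpResidual_eq_zero W p hirr hns h

/-- **`R♯(E,p) = 0 ⟹` pointwise `μ(X₀(E/ℚ_∞)) = 0`** (`Rank1Residual.FineMuZeroAt W p`) on the small-image locus.
[cite: CoatesSujatha2005, §3 statement (A), `μ`-form] -/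
theorem SharpResidualTrivialAt.fineMuZeroAt (h : SharpResidualTrivialAt W p)
    (hirr : W.HasIrreducibleModPGaloisRep p) (hns : ¬ W.HasSurjectiveModNGaloisRep p) : FineMuZeroAt W p :=
  fineMuZeroAt_of_irr_of_not_surj_of_sharpResidual_eq_zero W p hirr hns h

/-! ### §3 Doors on the route's domain `ClassX11a W p ∧ ¬ Surj W p` (U3 at `p = 3`, U5 at `p = 5`) -/

section X11a

variable [W.IsGloballyMinimal]

/-- **(A) at a non-surjective X11a pair from its ♯0 certificate** — the conclusion of `FineMu.stub_conjA_three` for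
THIS `W`.  PROVED, no named fact. [cite: CoatesSujatha2005, §3 statement (A)] -/
theorem ClassX11a.conjAAt_of_not_surj_of_sharpResidualTrivialAt (hX : ClassX11a W p) (hns : ¬ Surj W p)
    (h : SharpResidualTrivialAt W p) : ConjAAt W p :=
  h.conjAAt hX.irr hns

/-- **THE PER-PAIR ♯-DOOR TO THE MISSING UPPER BOUND**: at a non-surjective X11a pair, the ♯0 certificate
«`R♯(E,p) = 0`» gives `ord_p #Ш ≤ ord_p #Ш_an` (`Typed.MissingUpperBoundAt W p`) — ♯0 ⟹ (A) (this road, PROVED) ⟹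
x11a-p2's (A)-door `ClassX11a.missingUpperBoundAt_of_conjAAt` (transfer `stub_multDivisibilityAt_of_conjA` + the
landed engine), modulo the displayed printed facts of that door ONLY (no image bit, no (ram), no `μ`, no class
group, no (c3)).  CONDITIONAL on those facts; nothing asserted about any curve.
[cite: Kato2004Asterisque, §17.13 (pp. 279–280)] [cite: CoatesSujatha2005, §3 statement (A)]
[cite: SteinWuthrich2013, Thm. 6.1 (p. 20)] [cite: Wuthrich2014, Cor. 18 (p. 398)] [cite: Miller2011LMS, Def. 1.1] -/
theorem ClassX11a.missingUpperBoundAt_of_not_surj_of_sharpResidualTrivialAt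
    (hJs : thm61_splitMultiplicative) (hJn : thm61_nonsplitMultiplicative)
    (hGZK : rank_eq_analyticRank_of_analyticRank_le_one) (hpar : nonempty_modularParametrizationData)
    (h12 : Kato2004.thm12_4)
    (hnsI : Kato2004.exists_multDivisibilityInputs_nonsplit)
    (hsp : Kato2004.exists_multDivisibilityInputs_split)
    (h15 : thm15_isTorsion_multiplicative_rat)
    (h18 : Wuthrich2014.corollary18_padicLFunction_mem_iwasawaAlgebra_multiplicative)
    (hfine : Kato2004.exists_multDivisibilityInputs_fine)
    (hGS : greenberg_stevens (W := W) (p := p))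
    (hX : ClassX11a W p) (hns : ¬ Surj W p) (h : SharpResidualTrivialAt W p) :
    MissingUpperBoundAt W p :=
  ClassX11a.missingUpperBoundAt_of_conjAAt hJs hJn hGZK hpar h12 hnsI hsp h15 h18 hfine W p hGS hX
    (h.conjAAt hX.irr hns)

/-- **`BSD(E,p)` at a non-surjective X11a pair with a UNIT analytic Sha from its ♯0 certificate** (the booking
shape for the unit cells: certificate + displayed `#Ш_an = q`, `ord_p q = 0`; via x11a-p2's
`ClassX11a.bsdp_of_conjAAt_of_unit`).  CONDITIONAL on the door's printed facts; nothing asserted about any curve.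
[cite: Miller2011LMS, §1 and Def. 1.1] [cite: CoatesSujatha2005, §3 statement (A)] -/
theorem ClassX11a.bsdp_of_not_surj_of_sharpResidualTrivialAt_of_unit
    (hJs : thm61_splitMultiplicative) (hJn : thm61_nonsplitMultiplicative)
    (hGZK : rank_eq_analyticRank_of_analyticRank_le_one) (hpar : nonempty_modularParametrizationData)
    (h12 : Kato2004.thm12_4)
    (hnsI : Kato2004.exists_multDivisibilityInputs_nonsplit)
    (hsp : Kato2004.exists_multDivisibilityInputs_split)
    (h15 : thm15_isTorsion_multiplicative_rat)
    (h18 : Wuthrich2014.corollary18_padicLFunction_mem_iwasawaAlgebra_multiplicative)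
    (hfine : Kato2004.exists_multDivisibilityInputs_fine)
    (hGS : greenberg_stevens (W := W) (p := p))
    (hX : ClassX11a W p) (hns : ¬ Surj W p) (h : SharpResidualTrivialAt W p)
    {q : ℚ} (hq : shaAn W = (q : ℂ)) (hv : padicValRat p q = 0) : BSDp W p :=
  ClassX11a.bsdp_of_conjAAt_of_unit hJs hJn hGZK hpar h12 hnsI hsp h15 h18 hfine W p hGS hX
    (h.conjAAt hX.irr hns) hq hv

end X11a

end Summit.BirchSwinnertonDyer.Rank1Residual

/-! ### §4 Class forms: the registered stubs of Lines/finemu3.lean r1 from «`R♯ = 0` on the domain» -/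

namespace Summit.BirchSwinnertonDyer.BirchSwinnertonDyer.Theorems.UpperNonSurjThreeSharp

open Summit.BirchSwinnertonDyer.Rank1Residual

/-- **`stub_conjA_three` VERBATIM from ♯0 certificates on the whole U3 domain**: if every U3 pair
(`ClassX11a W 3`, `ρ̄_{W,3}` not onto) has `R♯(W,3) = 0`, then statement (A) holds at every U3 pair — the exact
conclusion of `Cruxes.UpperNonSurjThree.FineMu.stub_conjA_three` (any `p`, with `p = 3` as its binder).  PROVED
(pure composition); the hypothesis is a CLASS-WIDE certificate statement, open (and false wherever some U3 pair has
`X₀(E/ℚ_∞) ≠ 0`: ♯0 is the strong certificate — there the first-layer ♯δ or the Fukuda doors are the tools).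
[cite: CoatesSujatha2005, §3 statement (A)] [cite: DeoRaySujatha2023, Thm. 3.9] -/
theorem conjA_three_of_forall_sharpResidualTrivialAt
    (h : ∀ (W : WeierstrassCurve ℚ) [W.IsElliptic] [W.IsGloballyMinimal] (p : ℕ) [Fact p.Prime],
      ClassX11a W p → ¬ Surj W p → p = 3 → SharpResidualTrivialAt W p) :
    ∀ (W : WeierstrassCurve ℚ) [W.IsElliptic] [W.IsGloballyMinimal] (p : ℕ) [Fact p.Prime],
      ClassX11a W p → ¬ Surj W p → p = 3 → ConjAAt W p :=
  fun W _ _ p _ hX hns hp3 => (h W p hX hns hp3).conjAAt hX.irr hns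

/-- **`stub_conjA_hardThree` (LEAD reshape r1) VERBATIM from ♯0 certificates on the HARD sub-locus** {split at `p`}
∪ {`ord_p(L(E,1)/Ω_E) ≠ 0`} of U3.  PROVED (pure composition); hypothesis = class-wide certificate on the hard
locus, open. [cite: CoatesSujatha2005, §3 statement (A)] [cite: Kato2004Asterisque, §17.13 (pp. 279–280)] -/
theorem conjA_hardThree_of_forall_sharpResidualTrivialAt
    (h : ∀ (W : WeierstrassCurve ℚ) [W.IsElliptic] [W.IsGloballyMinimal] (p : ℕ) [Fact p.Prime],
      ClassX11a W p → ¬ Surj W p → p = 3 →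
      (W.HasSplitMultiplicativeReductionAtPrime p ∨
        ∀ t : ℚ, W.entireLFunction 1 / (W.realPeriodRat : ℂ) = (t : ℂ) → padicValRat p t ≠ 0) →
      SharpResidualTrivialAt W p) :
    ∀ (W : WeierstrassCurve ℚ) [W.IsElliptic] [W.IsGloballyMinimal] (p : ℕ) [Fact p.Prime],
      ClassX11a W p → ¬ Surj W p → p = 3 →
      (W.HasSplitMultiplicativeReductionAtPrime p ∨
        ∀ t : ℚ, W.entireLFunction 1 / (W.realPeriodRat : ℂ) = (t : ℂ) → padicValRat p t ≠ 0) →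
      ConjAAt W p :=
  fun W _ _ p _ hX hns hp3 hhard => (h W p hX hns hp3 hhard).conjAAt hX.irr hns

end Summit.BirchSwinnertonDyer.BirchSwinnertonDyer.Theorems.UpperNonSurjThreeSharp

/-! ### §5 (APPEND, seat bsd-line-x11a-p1-w2, 2026-08-28) Named certificates for records: the LOCAL level-0 form
«`R♭(E,p) = 0`» and the LAYER-`n` form «`#Y_n(E,p) < p^{pⁿ}`», with their doors (∘ `…SharpLocal` p609128,
`…SharpLayerDescent` p610827).  Two more PREDICATES with bodies (nothing asserted) + proved doors; a record displays
ONE of `SharpResidualTrivialAt W p` / `SharpLocalCertAt W p` / `SharpLayerCertAt W p n` as its certificate hypothesis. -/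

namespace Summit.BirchSwinnertonDyer.Rank1Residual

open scoped NumberField

open Literature.NumberTheory.EllipticCurves.GreenbergSelmer

/-- **`SharpLocalCertAt W p` — «`R♭(E,p) = 0`», the ♯0 certificate in its finite level-0 LOCAL form** (a predicate;
nothing asserted): for every cyclotomic `κ`, the only class `y ∈ H¹(G_ℚ, E[p]; S)` (`S = {bad} ∪ {v ∣ p}`, tree
`h1Unramified`) that is locally ♯-trivial at every finite place — `ι_v(res_{Gal(ℚ̄/ℚ_∞) ⊓ D_v} y) = 0`, i.e.
`loc_v y ∈ B_v = ker(H¹(ℚ_v, E[p]) → H¹(ℚ_{v,∞}, E[p^∞]))` — is `y = 0`.  Implies `SharpResidualTrivialAt W p`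
(`…SharpLocal`); decided per pair by a finite computation on `L = ℚ(E[p])` once the `B_v`, `v ∈ S`, are made explicit
(at tower-torsion-free places they are `E[p]`-statements, `…SharpLocalNoTorsion`).
[cite: GreenbergLNM1716, §3 Lemmas 3.1–3.3] [cite: SilvermanAEC2009, Lemma X.4.3 (`H¹(G_K, M; S)` finite)] -/
def SharpLocalCertAt (W : WeierstrassCurve ℚ) [W.IsElliptic] (p : ℕ) [Fact p.Prime] : Prop :=
  ∀ κ : ZpExtension ℚ p, κ.IsCyclotomic →
    ∀ y : discreteH1 (absoluteGaloisGroup ℚ) (geomTorsion W (p : ℤ)),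
      y ∈ h1Unramified (geomTorsion W (p : ℤ)) (W.badPlaces (𝓞 ℚ) ∪ {v | ((p : ℤ) : 𝓞 ℚ) ∈ v.asIdeal}) →
      (∀ v : IsDedekindDomain.HeightOneSpectrum (𝓞 ℚ),
        W.torsionToPrimaryH1Sub p (κ.kerSubgroup ⊓ decomp v)
          (ResKernel.resSubgroup (κ.kerSubgroup ⊓ decomp v) (geomTorsion W (p : ℤ)) y) = 0) →
      y = 0

/-- **`SharpLayerCertAt W p n` — «`#Y_n(E,p) < p^{pⁿ}`», the ♯δ certificate at layer `n`** (a predicate; nothing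
asserted): for every cyclotomic `κ`, the set `Y_n(κ) = {y ∈ H¹(Gal(ℚ̄/ℚ_n), E[p]) : ι(res_{ℚ_∞} y) ∈ Sel₀(ℚ_∞, E[p^∞])}`
of level-`n` classes (`subgroupH1 (κ.layerSubgroup n)`) is finite with fewer than `p^{pⁿ}` elements.  `n = 1` is the
line card's ♯δ («`dim_{𝔽_p} R♯(E/ℚ₁, p) ≤ p − 1`» in counting form).  Implies (A) on the small-image locus
(`…SharpLayerDescent`). [cite: Lang1990, Ch. 13 §1 Lemma 3] [cite: GreenbergLNM1716, §3 Lemma 3.2] -/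
def SharpLayerCertAt (W : WeierstrassCurve ℚ) [W.IsElliptic] (p : ℕ) [Fact p.Prime] (n : ℕ) : Prop :=
  ∀ κ : ZpExtension ℚ p, κ.IsCyclotomic →
    Set.Finite {y : subgroupH1 (κ.layerSubgroup n) (geomTorsion W (p : ℤ)) |
        W.torsionToPrimaryH1Sub p κ.kerSubgroup
          (resOfLe (geomTorsion W (p : ℤ)) (κ.kerSubgroup_le_layerSubgroup n) y) ∈ W.fineSelmerInfty κ} ∧
      Nat.card {y : subgroupH1 (κ.layerSubgroup n) (geomTorsion W (p : ℤ)) |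
        W.torsionToPrimaryH1Sub p κ.kerSubgroup
          (resOfLe (geomTorsion W (p : ℤ)) (κ.kerSubgroup_le_layerSubgroup n) y) ∈ W.fineSelmerInfty κ} <
        p ^ p ^ n

variable {W : WeierstrassCurve ℚ} [W.IsElliptic] {p : ℕ} [Fact p.Prime]

/-- Unfolding `SharpLocalCertAt` (`Iff.rfl`). [cite: GreenbergLNM1716, §3] -/
theorem sharpLocalCertAt_iff :
    SharpLocalCertAt W p ↔
      ∀ κ : ZpExtension ℚ p, κ.IsCyclotomic →
        ∀ y : discreteH1 (absoluteGaloisGroup ℚ) (geomTorsion W (p : ℤ)),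
          y ∈ h1Unramified (geomTorsion W (p : ℤ)) (W.badPlaces (𝓞 ℚ) ∪ {v | ((p : ℤ) : 𝓞 ℚ) ∈ v.asIdeal}) →
          (∀ v : IsDedekindDomain.HeightOneSpectrum (𝓞 ℚ),
            W.torsionToPrimaryH1Sub p (κ.kerSubgroup ⊓ decomp v)
              (ResKernel.resSubgroup (κ.kerSubgroup ⊓ decomp v) (geomTorsion W (p : ℤ)) y) = 0) →
          y = 0 :=
  Iff.rfl

/-- Unfolding `SharpLayerCertAt` (`Iff.rfl`). [cite: Lang1990, Ch. 13 §1 Lemma 3] -/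
theorem sharpLayerCertAt_iff (n : ℕ) :
    SharpLayerCertAt W p n ↔
      ∀ κ : ZpExtension ℚ p, κ.IsCyclotomic →
        Set.Finite {y : subgroupH1 (κ.layerSubgroup n) (geomTorsion W (p : ℤ)) |
            W.torsionToPrimaryH1Sub p κ.kerSubgroup
              (resOfLe (geomTorsion W (p : ℤ)) (κ.kerSubgroup_le_layerSubgroup n) y) ∈ W.fineSelmerInfty κ} ∧
          Nat.card {y : subgroupH1 (κ.layerSubgroup n) (geomTorsion W (p : ℤ)) |
            W.torsionToPrimaryH1Sub p κ.kerSubgroup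
              (resOfLe (geomTorsion W (p : ℤ)) (κ.kerSubgroup_le_layerSubgroup n) y) ∈ W.fineSelmerInfty κ} <
            p ^ p ^ n :=
  Iff.rfl

/-- The local certificate implies the global one: `R♭(E,p) = 0 ⟹ R♯(E,p) = 0` (`…SharpLocal`). PROVED.
[cite: GreenbergLNM1716, §3 Lemmas 3.1–3.3] -/
theorem SharpLocalCertAt.sharpResidualTrivialAt (h : SharpLocalCertAt W p) : SharpResidualTrivialAt W p :=
  sharpResidual_eq_zero_of_forall_local W p h

/-- **`R♭(E,p) = 0 ⟹` statement (A)** on the small-image locus. PROVED, no named fact.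
[cite: CoatesSujatha2005, §3 statement (A)] -/
theorem SharpLocalCertAt.conjAAt (h : SharpLocalCertAt W p) (hirr : W.HasIrreducibleModPGaloisRep p)
    (hns : ¬ W.HasSurjectiveModNGaloisRep p) : ConjAAt W p :=
  h.sharpResidualTrivialAt.conjAAt hirr hns

/-- **`#Y_n(E,p) < p^{pⁿ} ⟹` statement (A)** on the small-image locus (`…SharpLayerDescent`). PROVED, no named fact.
[cite: CoatesSujatha2005, §3 statement (A)] [cite: GreenbergLNM1716, §3 Lemma 3.2] -/
theorem SharpLayerCertAt.conjAAt {n : ℕ} (h : SharpLayerCertAt W p n) (hirr : W.HasIrreducibleModPGaloisRep p)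
    (hns : ¬ W.HasSurjectiveModNGaloisRep p) : ConjAAt W p :=
  conjAAt_of_irr_of_not_surj_of_forall_natCard_layerResidual_lt W p hirr hns n h

section X11aDoors

variable [W.IsGloballyMinimal]

/-- **(A) at a non-surjective X11a pair from `R♭(E,p) = 0`.** PROVED. [cite: CoatesSujatha2005, §3 statement (A)] -/
theorem ClassX11a.conjAAt_of_not_surj_of_sharpLocalCertAt (hX : ClassX11a W p) (hns : ¬ Surj W p)
    (h : SharpLocalCertAt W p) : ConjAAt W p :=
  h.conjAAt hX.irr hns

/-- **(A) at a non-surjective X11a pair from the layer-`n` certificate.** PROVED.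
[cite: CoatesSujatha2005, §3 statement (A)] -/
theorem ClassX11a.conjAAt_of_not_surj_of_sharpLayerCertAt (hX : ClassX11a W p) (hns : ¬ Surj W p) {n : ℕ}
    (h : SharpLayerCertAt W p n) : ConjAAt W p :=
  h.conjAAt hX.irr hns

/-- **The missing upper bound at a non-surjective X11a pair from `R♭(E,p) = 0`** (∘ x11a-p2's (A)-door p607408;
facts = that door's). CONDITIONAL on the displayed printed facts; nothing asserted about any curve.
[cite: Kato2004Asterisque, §17.13 (pp. 279–280)] [cite: CoatesSujatha2005, §3 statement (A)] [cite: Miller2011LMS, Def. 1.1] -/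
theorem ClassX11a.missingUpperBoundAt_of_not_surj_of_sharpLocalCertAt
    (hJs : thm61_splitMultiplicative) (hJn : thm61_nonsplitMultiplicative)
    (hGZK : rank_eq_analyticRank_of_analyticRank_le_one) (hpar : nonempty_modularParametrizationData)
    (h12 : Kato2004.thm12_4)
    (hnsI : Kato2004.exists_multDivisibilityInputs_nonsplit)
    (hsp : Kato2004.exists_multDivisibilityInputs_split)
    (h15 : thm15_isTorsion_multiplicative_rat)
    (h18 : Wuthrich2014.corollary18_padicLFunction_mem_iwasawaAlgebra_multiplicative)
    (hfine : Kato2004.exists_multDivisibilityInputs_fine)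
    (hGS : greenberg_stevens (W := W) (p := p))
    (hX : ClassX11a W p) (hns : ¬ Surj W p) (h : SharpLocalCertAt W p) :
    MissingUpperBoundAt W p :=
  ClassX11a.missingUpperBoundAt_of_not_surj_of_sharpResidualTrivialAt hJs hJn hGZK hpar h12 hnsI hsp h15 h18
    hfine hGS hX hns h.sharpResidualTrivialAt

/-- **The missing upper bound at a non-surjective X11a pair from the layer-`n` certificate** (∘ p607408).
CONDITIONAL on the displayed printed facts; nothing asserted about any curve.
[cite: Kato2004Asterisque, §17.13 (pp. 279–280)] [cite: CoatesSujatha2005, §3 statement (A)] [cite: Miller2011LMS, Def. 1.1] -/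
theorem ClassX11a.missingUpperBoundAt_of_not_surj_of_sharpLayerCertAt
    (hJs : thm61_splitMultiplicative) (hJn : thm61_nonsplitMultiplicative)
    (hGZK : rank_eq_analyticRank_of_analyticRank_le_one) (hpar : nonempty_modularParametrizationData)
    (h12 : Kato2004.thm12_4)
    (hnsI : Kato2004.exists_multDivisibilityInputs_nonsplit)
    (hsp : Kato2004.exists_multDivisibilityInputs_split)
    (h15 : thm15_isTorsion_multiplicative_rat)
    (h18 : Wuthrich2014.corollary18_padicLFunction_mem_iwasawaAlgebra_multiplicative)
    (hfine : Kato2004.exists_multDivisibilityInputs_fine)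
    (hGS : greenberg_stevens (W := W) (p := p))
    (hX : ClassX11a W p) (hns : ¬ Surj W p) {n : ℕ} (h : SharpLayerCertAt W p n) :
    MissingUpperBoundAt W p :=
  ClassX11a.missingUpperBoundAt_of_conjAAt hJs hJn hGZK hpar h12 hnsI hsp h15 h18 hfine W p hGS hX
    (h.conjAAt hX.irr hns)

end X11aDoors

end Summit.BirchSwinnertonDyer.Rank1Residual

end
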